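import Mathlib
import Summits.NavierStokesRegularity.OSWSelfSimilar.SheetNSLineTorusCascadeKernelCellU1983
import Summits.NavierStokesRegularity.OSWSelfSimilar.SheetNSLineTorusCascadeKernelCellL1976
import HarnessLib

/-!
# Viscous CLM on the torus (`a = 0`, `σ = 2`): THE DATUM-FREE KERNEL BRACKET `[19.76, 19.83]·ν` for the sine datum — one citation
# (reflective cell-chain certificate, refined run: 675 cells of `log(4096/4093)`, `K = 100` on the blow-up side)

HONEST FRAMING (cell ns-blowup GROUP B «PROFILE SEARCH», zone Z3, row Z3-U addendum A-F2 of `HOME/profile/z3/CENSUS-Z3.md`;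
human rulings D-0035/D-0074; Z3-TWIN lineage, eng-5 g13): **1-D MODEL (viscous Constantin–Lax–Majda equation `ω_t = ω Hω + ν ω_xx`
on `𝕋`, `H = hilbertTransformCircle`); conjunction of kernel theorems; not Euler, not Navier–Stokes; «violates: none — MODEL».
NO script datum: the fixed-point envelopes of `SheetNSLineTorusCascadeKernelCellU1983Run` / `…L1976Run` are evaluated by the Lean
kernel (`decide`, standard axioms) and their meaning is the theorem `CellChain.runB_sound`.**

* `horizon_cellFine_lt` — `600·log(2^12/4093) < 2199/5000` (`log x < x − 1`);
* `datumFree_bracket_cellFine` — for every `ν > 0` and `c ≥ 0`: if `c < (494/25)ν = 19.76ν` the MODEL PDE has a GLOBAL classical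
  `2π`-periodic solution from `ω(0,·) = −c sin` (`exists_global_classicalSolution_of_lt_nineteenSeventySix`), and if
  `c ≥ (1983/100)ν = 19.83ν` every classical solution from that datum has horizon `T < 0.4398/ν`
  (`horizon_lt_of_le_nineteenEightyThree`);
* `datumFree_bracket_cellFine_gen` — the blow-up half for every odd datum `−Σ a_k sin kx` with `a_k ≥ 0`, `a₁ ≥ (1983/100)ν`.
Previous datum-free kernel brackets: `[19, 20.5]·ν` (`SheetNSLineTorusCascadeKernelBracket`, eng-5 g12), `[19.74, 19.9]·ν`
(`SheetNSLineTorusCascadeKernelCellBracket`, coarser run); located threshold `19.7756ν`;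
script-certified interval `[19.7755478, 19.7766876]·ν` (distinct tier). bears_on: LADDER-NS N5 / zone Z3 (row Z3-U) → N1 linear core.
WHAT THIS IS NOT: not NS; no definitions.
-/

namespace Summit.NavierStokesRegularity.OSWSelfSimilar
namespace SheetNSLineTorusCascade

open Finset Real Set

/-- The blow-up horizon of the `19.83ν` certificate is below `0.4398`: `600·log(4096/4093) < 600·(3/4093) < 2199/5000`. [folklore] -/
theorem horizon_cellFine_lt : ((600 : ℕ) : ℝ) * Real.log (2 ^ 12 / ((4093 : ℕ) : ℝ)) < 2199 / 5000 := by
  have h := Real.log_lt_sub_one_of_pos (x := (2 : ℝ) ^ 12 / ((4093 : ℕ) : ℝ)) (by norm_num) (by norm_num)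
  push_cast at h ⊢
  nlinarith

/-- **THE DATUM-FREE KERNEL BRACKET (sine datum), refined reflective certificate.** For `ν > 0`, `c ≥ 0`: a global classical solution
from `−c sin x` if `c < (494/25)ν`; no classical solution on `[0, 0.4398/ν]` if `c ≥ (1983/100)ν`. [new here — MODEL] -/
theorem datumFree_bracket_cellFine {ν c : ℝ} (hν : 0 < ν) (hc : 0 ≤ c) :
    (c < 494 / 25 * ν → ∃ ω ωt ωx ωxx : ℝ → ℝ → ℝ, (∀ x, ω 0 x = -c * Real.sin x) ∧ ∀ T : ℝ, IsClassicalSolution ν T ω ωt ωx ωxx) ∧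
    (1983 / 100 * ν ≤ c → ∀ {T : ℝ} {ω ωt ωx ωxx : ℝ → ℝ → ℝ}, IsClassicalSolution ν T ω ωt ωx ωxx →
      (∀ x, ω 0 x = -c * Real.sin x) → T < 2199 / 5000 / ν) := by
  refine ⟨fun hlt => exists_global_classicalSolution_of_lt_nineteenSeventySix hν hc hlt, fun hge T ω ωt ωx ωxx h hω0 => ?_⟩
  exact lt_trans (horizon_lt_of_le_nineteenEightyThree h hω0 hν hge) (div_lt_div_of_pos_right horizon_cellFine_lt hν)

/-- **The blow-up half for the general odd class (refined).** A classical `2π`-periodic solution on `[0, T]` whose datum has cascade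
variables `coef ω k 0 = a_k ∈ ℝ`, `a_k ≥ 0`, mean zero, `a₁ ≥ (1983/100)ν` (`ν > 0`) has `T < 0.4398/ν`. [new here — MODEL] -/
theorem datumFree_bracket_cellFine_gen {ν T : ℝ} {ω ωt ωx ωxx : ℝ → ℝ → ℝ} (h : IsClassicalSolution ν T ω ωt ωx ωxx)
    {a : ℕ → ℝ} (hdat : ∀ k : ℕ, coef ω k 0 = ((a k : ℝ) : ℂ)) (ha : ∀ k, 0 ≤ a k) (hmean : mode ω 0 0 = 0)
    (hν : 0 < ν) (hc : 1983 / 100 * ν ≤ a 1) : T < 2199 / 5000 / ν :=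
  lt_trans (horizon_lt_of_le_nineteenEightyThree_gen h hdat ha hmean hν hc) (div_lt_div_of_pos_right horizon_cellFine_lt hν)

end SheetNSLineTorusCascade
end Summit.NavierStokesRegularity.OSWSelfSimilar
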